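import Summits.CriticalPhenomena.CardyFormulaZ2.Theorems.CardyBoundaryCoulombGasStripClusterRatesConfinedGlueTransfer
import Literature.Probability.Percolation.KSTPeriodicTopology
import HarnessLib

/-!
# Docking order of two distinct spanning clusters of a rectangle (stub `c8_dockingOrder`, T1a)

Support file for line `two-cluster-rate-is-stationary-gap` (crux `StripClusterRates`, stmt-CriticalPhenomena-13878),
lead c8. On a lattice configuration let `R = [0,m]×[0,n]` carry two open left-right crossings `x₁ ↝ y₁`, `x₂ ↝ y₂`
whose left endpoints are not joined inside `R` (the two-cluster event `E₂` of the crux). Order the left endpoints,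
say `(x₁)₁ < (x₂)₁`. Then the cluster HIGH of `x₂` inside `R` is docked strictly above the crossing `x₁ ↝ y₁` at the
boundary (`c8_dockingOrder`, registered stub T1a of lead c8):
* HIGH contains no bottom-side vertex;
* every left-side vertex of HIGH lies strictly above `x₁`;
* every right-side vertex of HIGH lies strictly above `y₁`.
All three are instances of one planar fact (`dko_meet`): a lattice path of `R` from `x₂` to a vertex `c` of the lower
boundary arc cut out by the crossing `x₁ ↝ y₁` (bottom side, left side strictly below `x₁`, right side strictly below
`y₁`) meets that crossing. Proof: extend the crossing by one step to the left and one step to the right, and the path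
by the hook `(-1, n+1) → (-1, (x₂)₁) → x₂` at its start and a hook from `c` to the row `-1` at its end (straight down
from a bottom vertex, through the column `-1` from a left vertex, through the column `m+1` from a right vertex); the
extensions are a left-right and a top-bottom crossing of `[-1,m+1]×[-1,n+1]`, hence meet
(`exists_mem_support_of_crossing`, packaged as `KSTPeriodic.meet_of_extensions`), and the added runs are pairwise
disjoint and meet `R` only at their attachment vertices, so the meeting vertex is a common vertex of the two original
paths. For open paths it would join `x₁` to `x₂` inside `R`.

References: Kesten, *Percolation theory for mathematicians* (1982), §2.2; Bollobás–Riordan, *Percolation* (2006),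
Ch. 3 (horizontal and vertical crossings of a rectangle meet); [Aizenman1997] (distinct spanning clusters of a strip
are vertically ordered).
-/

noncomputable section

open MeasureTheory Filter Topology Set
open Literature.Probability.LatticeModels Literature.Probability.Percolation
open Summit.CriticalPhenomena.CardyFormulaZ2.Theorems.StripClusterRates.Negative (pOne pTwo rateSeqTwo rateSeqOne)

namespace Summit.CriticalPhenomena.CardyFormulaZ2.Cruxes.StripClusterRates.TwoClusterRateIsStationaryGap

open SimpleGraph

/-! ## §1 The planar core: a path from the upper left endpoint to the lower boundary arc meets the lower crossing -/

/-- **Planar core of the docking order.** In `[0,m]×[0,n]` let `P` be a lattice walk from a left-side vertex `x₁`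
to a right-side vertex `y₁`, and `W` a lattice walk from a left-side vertex `x₂` strictly above `x₁` to a vertex `c`
of the lower boundary arc cut out by `P`: `c` on the bottom row, or on the left column strictly below `x₁`, or on the
right column strictly below `y₁`. Then `P` and `W` have a common vertex. (Kesten 1982, §2.2; Bollobás–Riordan 2006,
Ch. 3: extended to `[-1,m+1]×[-1,n+1]`, the two walks become a left-right and a top-bottom crossing.) [folklore] -/
theorem dko_meet {m n : ℕ} {x₁ y₁ x₂ c : Site 2} (P : (zdGraph 2).Walk x₁ y₁) (W : (zdGraph 2).Walk x₂ c)
    (hP : ∀ z ∈ P.support, z ∈ (rectangle m n : Set (Site 2)))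
    (hW : ∀ z ∈ W.support, z ∈ (rectangle m n : Set (Site 2)))
    (hx₁ : x₁ 0 = 0) (hy₁ : y₁ 0 = m) (hx₂ : x₂ 0 = 0) (hlt : x₁ 1 < x₂ 1)
    (hc : c 1 = 0 ∨ (c 0 = 0 ∧ c 1 < x₁ 1) ∨ (c 0 = m ∧ c 1 < y₁ 1)) :
    ∃ z ∈ P.support, z ∈ W.support := by
  have hPb : ∀ z ∈ P.support, (0 : ℤ) ≤ z 0 ∧ z 0 ≤ (m : ℤ) ∧ (0 : ℤ) ≤ z 1 ∧ z 1 ≤ (n : ℤ) := fun z hz =>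
    mem_rectangle_iff.1 (Finset.mem_coe.1 (hP z hz))
  have hWb : ∀ z ∈ W.support, (0 : ℤ) ≤ z 0 ∧ z 0 ≤ (m : ℤ) ∧ (0 : ℤ) ≤ z 1 ∧ z 1 ≤ (n : ℤ) := fun z hz =>
    mem_rectangle_iff.1 (Finset.mem_coe.1 (hW z hz))
  have hx₁b := hPb x₁ P.start_mem_support
  have hy₁b := hPb y₁ P.end_mem_support
  have hx₂b := hWb x₂ W.start_mem_support
  have hcb := hWb c W.end_mem_support
  -- the column of the lower hook: `c₀` (bottom vertex), `-1` (left vertex), `m + 1` (right vertex)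
  obtain ⟨a, ha⟩ : ∃ a : ℤ, (a = c 0 ∧ c 1 = 0) ∨ (a = -1 ∧ c 0 = 0 ∧ c 1 < x₁ 1) ∨
      (a = (m : ℤ) + 1 ∧ c 0 = (m : ℤ) ∧ c 1 < y₁ 1) := by
    rcases hc with h | ⟨h0, h1⟩ | ⟨h0, h1⟩
    · exact ⟨c 0, Or.inl ⟨rfl, h⟩⟩
    · exact ⟨-1, Or.inr (Or.inl ⟨rfl, h0, h1⟩)⟩
    · exact ⟨(m : ℤ) + 1, Or.inr (Or.inr ⟨rfl, h0, h1⟩)⟩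
  -- the extensions: `A ++ P ++ E` from `(-1,(x₁)₁)` to `(m+1,(y₁)₁)`, `D ++ W ++ C` from `(-1,n+1)` to `(a,-1)`
  obtain ⟨p', A, hp'0, hp'1, hA⟩ := KSTPeriodic.exists_hookWalk_hv (-1) (x₁ 1) x₁
  obtain ⟨q', E, hq'0, hq'1, hE⟩ := KSTPeriodic.exists_hookWalk_from_hv y₁ ((m : ℤ) + 1) (y₁ 1)
  obtain ⟨u', D, hu'0, hu'1, hD⟩ := KSTPeriodic.exists_hookWalk_vh (-1) ((n : ℤ) + 1) x₂
  obtain ⟨v', C, hv'0, hv'1, hC⟩ := KSTPeriodic.exists_hookWalk_from_hv c a (-1)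
  refine KSTPeriodic.meet_of_extensions (L := 0) (R := m) (B := 0) (T := n) (L' := -1) (R' := (m : ℤ) + 1)
    (B' := -1) (T' := (n : ℤ) + 1) P W (A.append (P.append E)) (D.append (W.append C))
    (fun z => z ∈ A.support ∨ z ∈ E.support) (fun z => z ∈ D.support ∨ z ∈ C.support)
    hPb hWb (by omega) (fun z hz => KSTPeriodic.mem_support_append3 hz)
    (fun z hz => KSTPeriodic.mem_support_append3 hz) ?_ ?_ ?_ ?_ ?_ (Or.inl ⟨hp'0, hq'0⟩) (Or.inl ⟨hu'1, hv'1⟩)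
  · rintro z (hz | hz)
    · have := hA z hz; omega
    · have := hE z hz; omega
  · rintro z (hz | hz)
    · have := hD z hz; omega
    · have := hC z hz; omega
  · rintro z (hz | hz) hb
    · have := hA z hz
      exact KSTPeriodic.mem_support_of_eq_start P (by omega) (by omega)
    · have := hE z hz
      exact KSTPeriodic.mem_support_of_eq_end P (by omega) (by omega)
  · rintro z (hz | hz) hb
    · have := hD z hz
      exact KSTPeriodic.mem_support_of_eq_start W (by omega) (by omega)
    · have := hC z hz
      exact KSTPeriodic.mem_support_of_eq_end W (by omega) (by omega)
  · rintro z (hz | hz) (hz' | hz') hb <;> exfalso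
    · have := hA z hz; have := hD z hz'; omega
    · have := hA z hz; have := hC z hz'; omega
    · have := hE z hz; have := hD z hz'; omega
    · have := hE z hz; have := hC z hz'; omega

/-! ## §2 Open paths: the upper cluster is docked above the lower crossing -/

/-- **The upper cluster avoids the lower boundary arc.** On a lattice configuration, if `x₁ ↝ y₁` is an open
left-right crossing of `[0,m]×[0,n]`, `x₂` a left-side vertex strictly above `x₁` not joined to `x₁` inside the
rectangle, then `x₂` is joined inside the rectangle to no vertex `c` of the bottom row, of the left column strictly
below `x₁`, or of the right column strictly below `y₁` (a joining path would meet the crossing, `dko_meet`, and the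
meeting vertex would join `x₁` to `x₂`). [folklore] -/
theorem dko_not_openConnIn {m n : ℕ} {ω : BondConfig (Site 2)} (hω : ω ⊆ (zdGraph 2).edgeSet) {x₁ y₁ x₂ c : Site 2}
    (hx₁ : x₁ ∈ (leftSide m n : Set (Site 2))) (hy₁ : y₁ ∈ (rightSide m n : Set (Site 2)))
    (hx₂ : x₂ ∈ (leftSide m n : Set (Site 2))) (hlt : x₁ 1 < x₂ 1)
    (h₁ : ω ∈ openConnIn (rectangle m n : Set (Site 2)) x₁ y₁)
    (h₁₂ : ω ∉ openConnIn (rectangle m n : Set (Site 2)) x₁ x₂)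
    (hc : c 1 = 0 ∨ (c 0 = 0 ∧ c 1 < x₁ 1) ∨ (c 0 = m ∧ c 1 < y₁ 1)) :
    ω ∉ openConnIn (rectangle m n : Set (Site 2)) x₂ c := by
  classical
  intro h₂c
  obtain ⟨P, hPS, hPω⟩ := exists_walk_of_mem_openConnIn hω h₁
  obtain ⟨W, hWS, hWω⟩ := exists_walk_of_mem_openConnIn hω h₂c
  obtain ⟨v, hvP, hvW⟩ := dko_meet P W hPS hWS (Finset.mem_filter.1 (Finset.mem_coe.1 hx₁)).2
    (Finset.mem_filter.1 (Finset.mem_coe.1 hy₁)).2 (Finset.mem_filter.1 (Finset.mem_coe.1 hx₂)).2 hlt hc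
  have c₁ : ω ∈ openConnIn (rectangle m n : Set (Site 2)) x₁ v := mem_openConnIn_of_mem_support P hPS hPω hvP
  have c₂ : ω ∈ openConnIn (rectangle m n : Set (Site 2)) x₂ v := mem_openConnIn_of_mem_support W hWS hWω hvW
  rw [openConnIn_comm] at c₂
  exact h₁₂ (PlanarDuality.openConnIn_trans c₁ c₂)

/-- **Docking order, ordered form.** With the left endpoints ordered, `(x₁)₁ < (x₂)₁`, the cluster of `x₂` inside
`[0,m]×[0,n]` touches no bottom-side vertex, and its left-side (resp. right-side) vertices lie strictly above `x₁`
(resp. `y₁`); the boundary cases `z = x₁`, `z = y₁` are excluded directly by `x₁ ↮ x₂`. [folklore] -/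
theorem dko_ordered {m n : ℕ} {ω : BondConfig (Site 2)} (hω : ω ⊆ (zdGraph 2).edgeSet) {x₁ y₁ x₂ : Site 2}
    (hx₁ : x₁ ∈ (leftSide m n : Set (Site 2))) (hy₁ : y₁ ∈ (rightSide m n : Set (Site 2)))
    (hx₂ : x₂ ∈ (leftSide m n : Set (Site 2))) (hlt : x₁ 1 < x₂ 1)
    (h₁ : ω ∈ openConnIn (rectangle m n : Set (Site 2)) x₁ y₁)
    (h₁₂ : ω ∉ openConnIn (rectangle m n : Set (Site 2)) x₁ x₂) :
    (∀ z ∈ (bottomSide m n : Set (Site 2)), ω ∉ openConnIn (rectangle m n : Set (Site 2)) x₂ z) ∧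
    (∀ z ∈ (leftSide m n : Set (Site 2)), ω ∈ openConnIn (rectangle m n : Set (Site 2)) x₂ z → x₁ 1 < z 1) ∧
    (∀ z ∈ (rightSide m n : Set (Site 2)), ω ∈ openConnIn (rectangle m n : Set (Site 2)) x₂ z → y₁ 1 < z 1) := by
  refine ⟨fun z hz => ?_, fun z hz hxz => ?_, fun z hz hxz => ?_⟩
  · exact dko_not_openConnIn hω hx₁ hy₁ hx₂ hlt h₁ h₁₂ (Or.inl (Finset.mem_filter.1 (Finset.mem_coe.1 hz)).2)
  · have hz0 := (Finset.mem_filter.1 (Finset.mem_coe.1 hz)).2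
    rcases lt_or_ge (x₁ 1) (z 1) with h | hle
    · exact h
    · exfalso
      rcases hle.lt_or_eq with hlt' | heq
      · exact dko_not_openConnIn hω hx₁ hy₁ hx₂ hlt h₁ h₁₂ (Or.inr (Or.inl ⟨hz0, hlt'⟩)) hxz
      · have hzx : z = x₁ := Site.eq_iff_two.2 ⟨hz0.trans (Finset.mem_filter.1 (Finset.mem_coe.1 hx₁)).2.symm, heq⟩
        subst hzx
        rw [openConnIn_comm] at hxz
        exact h₁₂ hxz
  · have hz0 := (Finset.mem_filter.1 (Finset.mem_coe.1 hz)).2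
    rcases lt_or_ge (y₁ 1) (z 1) with h | hle
    · exact h
    · exfalso
      rcases hle.lt_or_eq with hlt' | heq
      · exact dko_not_openConnIn hω hx₁ hy₁ hx₂ hlt h₁ h₁₂ (Or.inr (Or.inr ⟨hz0, hlt'⟩)) hxz
      · have hzy : z = y₁ := Site.eq_iff_two.2 ⟨hz0.trans (Finset.mem_filter.1 (Finset.mem_coe.1 hy₁)).2.symm, heq⟩
        subst hzy
        rw [openConnIn_comm] at hxz
        exact h₁₂ (PlanarDuality.openConnIn_trans h₁ hxz)

/-! ## §3 The registered stub -/

/-- **Docking order (stub T1a of lead c8, line `two-cluster-rate-is-stationary-gap`).** On the two-cluster event of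
`R = [0,m]×[0,n]` (two open left-right crossings whose left endpoints are not joined inside `R`) one can name an UPPER
crossing `x ↝ y` and a LOWER crossing `x' ↝ y'` such that the cluster of `x` inside `R` contains no bottom-side
vertex and all its left-side (resp. right-side) vertices lie strictly above `x'` (resp. `y'`): order the two left
endpoints by height and apply `dko_ordered`. [folklore] -/
theorem c8_dockingOrder : ∀ (m n : ℕ) (ω : BondConfig (Site 2)), 1 ≤ m → ω ⊆ (zdGraph 2).edgeSet →
    (∃ x₁ ∈ (leftSide m n : Set (Site 2)), ∃ y₁ ∈ (rightSide m n : Set (Site 2)), ∃ x₂ ∈ (leftSide m n : Set (Site 2)), ∃ y₂ ∈ (rightSide m n : Set (Site 2)), ω ∈ openConnIn (rectangle m n : Set (Site 2)) x₁ y₁ ∧ ω ∈ openConnIn (rectangle m n : Set (Site 2)) x₂ y₂ ∧ ω ∉ openConnIn (rectangle m n : Set (Site 2)) x₁ x₂) →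
    ∃ x ∈ (leftSide m n : Set (Site 2)), ∃ y ∈ (rightSide m n : Set (Site 2)), ∃ x' ∈ (leftSide m n : Set (Site 2)), ∃ y' ∈ (rightSide m n : Set (Site 2)),
      ω ∈ openConnIn (rectangle m n : Set (Site 2)) x y ∧ ω ∈ openConnIn (rectangle m n : Set (Site 2)) x' y' ∧
      (∀ z ∈ (bottomSide m n : Set (Site 2)), ω ∉ openConnIn (rectangle m n : Set (Site 2)) x z) ∧
      (∀ z ∈ (leftSide m n : Set (Site 2)), ω ∈ openConnIn (rectangle m n : Set (Site 2)) x z → x' 1 < z 1) ∧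
      (∀ z ∈ (rightSide m n : Set (Site 2)), ω ∈ openConnIn (rectangle m n : Set (Site 2)) x z → y' 1 < z 1) := by
  intro m n ω _ hω h
  obtain ⟨x₁, hx₁, y₁, hy₁, x₂, hx₂, y₂, hy₂, h₁, h₂, h₁₂⟩ := h
  have hx₁' := Finset.mem_filter.1 (Finset.mem_coe.1 hx₁)
  have hx₂' := Finset.mem_filter.1 (Finset.mem_coe.1 hx₂)
  have hne : x₁ 1 ≠ x₂ 1 := by
    intro heq
    have hxx : x₁ = x₂ := Site.eq_iff_two.2 ⟨hx₁'.2.trans hx₂'.2.symm, heq⟩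
    exact h₁₂ (hxx ▸ openConnIn_refl (Finset.mem_coe.2 hx₁'.1))
  rcases lt_or_gt_of_ne hne with hlt | hgt
  · obtain ⟨hb, hl, hr⟩ := dko_ordered hω hx₁ hy₁ hx₂ hlt h₁ h₁₂
    exact ⟨x₂, hx₂, y₂, hy₂, x₁, hx₁, y₁, hy₁, h₂, h₁, hb, hl, hr⟩
  · rw [openConnIn_comm] at h₁₂
    obtain ⟨hb, hl, hr⟩ := dko_ordered hω hx₂ hy₂ hx₁ hgt h₂ h₁₂
    exact ⟨x₁, hx₁, y₁, hy₁, x₂, hx₂, y₂, hy₂, h₁, h₂, hb, hl, hr⟩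

end Summit.CriticalPhenomena.CardyFormulaZ2.Cruxes.StripClusterRates.TwoClusterRateIsStationaryGap

end
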